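import Summits.QuantumFields.BalabanUV.Beta.EriceRemainderEnclosureHistoryAutonomy
import Summits.QuantumFields.BalabanUV.Beta.EriceRemainderEnclosureHistoryAutonomyWellPosed

/-!
# EriceRemainderEnclosureHistoryAutonomyEnd — (E37c) THE INTRINSIC CHARACTERISATION OF THE CONTINUUM RUNNING COUPLING WITHOUT FADING
# MEMORY: the k-uniform ROW total weight `Σ_{i≤k} Λ k i ≤ M` of node U2's history modulus IS the zeroth moment of the limit functional
# `betaInf β` (`|betaInf β u − betaInf β u′| ≤ M·D` for entrywise `D`-close box histories); hence — (E37a) identification + (E37b)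
# well-posedness — under node U2's binder list with `FadingMemory Cm θs Λ` REPLACED by rows `≤ M` and `Cm·γ < b(1−θs)` by `M·γ < b`, and
# under (E33)'s rows-only classes as they stand, ANY box solution of the `betaInf β`-flow from `g_IR` IS `gstar g`, it is the lattice-free
# Picard limit `solution (betaInf β) g_IR`, and the continuum running coupling depends on the β-family ONLY through `betaInf β`, Lipschitz

Cell `pub-balaban`, β-function sub-cell, BINDER row D4 «RemainderConst leaves for Bałaban's split» (`HOME/BINDER-OWNERS.md`; owner
lineage `b2b-balaban-beta-an4`; this file by co-owner #2 lineage `b2b-balaban-beta-d4-p2`, generation 39), β-FLOW TEAM duty (1),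
FREEZE (0) honoured (def-free END module; imports (E37a) + (E37b); node U2's `T4BetaFlowWellPosed` §5 names — `eq_gstar_of_memFlow`,
`gstar_eq_solution`, `abs_gstar_sub_gstar_le_of_betaInf_close`, `gstar_eq_gstar_of_betaInf_agree` — are re-derived on the weaker binder
lists, nothing of node U2's is restated or modified).

HONEST FRAMING (page 1, verbatim and binding).  *"Discharging BetaPertH makes Bałaban's UV stability UNCONDITIONAL — a real
constructive-QFT result; it is NOT the continuum limit and NOT the Clay problem."*  THIS FILE DISCHARGES NOTHING OF THE KIND.  Elementary
real analysis on node U2's typed HYPOTHESIS SHAPES over an ABSTRACT family `β : FlowStep.HBeta`: `ScaleShiftRate c θ γ β` (NE4; NOT PRINTED,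
GAPS G-t4-U2-1), `HistLipschitz Λ γ β` with `Λ ≥ 0` and a k-uniform ROW total weight (NOT PRINTED, GAPS G-t4-U2-2; [I] p. 298 says only
that the dependence on the preceding couplings exists), node U2's output shape `InjectedRate C 0 θ₁` (§2) or (E33)'s sign ∕ floor ∕
smallness (§3; floor = shape of (0.31)'s lower half, NOT PRINTED as a theorem) — NONE asserted for [I] (1.22); nothing of Bałaban's quoted
newly (loci (0.20) p. 256, (0.31) p. 259, p. 264, p. 298 verbatim in the headers of `FlowStep` ∕ `T4CouplingMatching`).  Row D4 class
UNCHANGED (critical-path width 0; instance 0∕1; D4 DISCHARGE NO DATE).  HONEST DEPENDENCY: continuum YM on T⁴ ⇐ BetaPertH ∧ nine spine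
estimates (0/9 proved); BetaPertH ⇐ (D1) ∧ (D4) ∧ CAP+tail; G-an2-4 gates asym, D1 and NE2/3/4.

THE POINT (census sense (α); the AUTONOMY row, END).  Node U2 (`T4BetaFlowWellPosed` §5): under «`InjectedRate`, `ScaleShiftRate`,
`HistLipschitz Λ`, `FadingMemory Cm θs Λ`, `EventualLowerH b`, `Cm·γ < b(1−θs)`» the continuum running coupling `gstar g` is THE unique box
solution of the flow with memory of `betaInf β` from `g_IR` — characterised intrinsically, no reference to the approximating lattice family —
and depends on `β` only through `betaInf β`, Lipschitz.  HERE the fading binder is deleted throughout: §1 the rows of `HistLipschitz` pass to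
the limit functional as the ZEROTH MOMENT (`le_of_tendsto` on node U2's `tendsto_betaInf`; no reindexing by age, no profile), so (E37b)
applies to `B = betaInf β` with `q = M·γ∕b`; §2 node U2's four §5 theorems on the binder list «`InjectedRate C 0 θ₁`, boxes, `RGEqH`, pin,
`ScaleShiftRate c θs γ β`, `HistLipschitz Λ γ β`, `Λ ≥ 0`, rows `≤ M`, `EventualLowerH b γ k₀ β`, `M·γ < b`» ((E37a) `memFlow_gstar_of_injectedRate`
+ (E37b) `memFlow_unique_zm` ∕ `memFlow_stability_zm` ∕ `eq_solution_of_memFlow_zm`); §3 the same on (E33)'s rows-only SIGN class AS IT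
STANDS (its smallness `M·((k₀+1)γ³ + 2γ∕b) < 1` already gives `M·γ < b∕2`; existence of `gstar g` from (E33d) through (E37a)
`memFlow_gstar_of_sign`): `∃! h, SeqBox γ h ∧ MemFlow (betaInf β) g_IR h`, `= gstar g = solution (betaInf β) g_IR`, and two families in the
class with the same pin and the same limit functional on the box have the SAME continuum running coupling.  So the AUTONOMY row of the
history channel's moment table reads, complete: diagonal ⟶ NE4's convergence (uniform); history ⟶ NOTHING for the identification ((E37a)),
the zeroth moment with `M·γ < b` for the intrinsic characterisation ((E37b) + here) — the currency and degree of (E32)'s uniqueness and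
(E33)'s existence; the decay of the memory in the age (node U2's `FadingMemory`, (E30)'s first moment, (E36)'s exponential moment) is the
price of RATES and of the two-loop VALUE only.  What is NOT claimed: anything for a modulus WITHOUT a k-uniform row budget (the analytic road's `γ²√(k+1)∕6`
rows, (E31c), are outside); anything about Bałaban's (1.22) or its limit functional.

WHAT IS PROVED ([folklore]; 0 `def`, 0 sorry).
 §1 **`zerothMoment_betaInf_of_rows`**, `rowBound_nonneg`, `abs_betaInf_sub_betaInf_le_of_close`, `abs_betaInf_sub_le_of_rows` (`≤ M·γ`),
    `abs_bstar_sub_bstar_le_of_rows`.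
 §2 **`eq_gstar_of_memFlow_rows`**, `existsUnique_memFlow_betaInf_rows`, `gstar_eq_solution_rows`, **`abs_gstar_sub_gstar_le_of_betaInf_close_rows`**,
    `gstar_eq_gstar_of_betaInf_agree_rows` (node U2's §5 with `FadingMemory` deleted).
 §3 **`eq_gstar_of_memFlow_sign`**, **`existsUnique_memFlow_betaInf_sign`**, `gstar_eq_solution_sign`, **`abs_gstar_sub_gstar_le_of_beta_close_sign`**,
    **`gstar_eq_gstar_of_betaInf_agree_sign`**
    ((E33)'s sign class as it stands), `smallness_of_E33` ∕ `_eventual`, `eq_gstar_of_memFlow_eventual` (eventual class as it stands).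
-/

noncomputable section
open Filter Topology Finset

namespace Summit.QuantumFields.BalabanUV.Beta.EriceRemainderEnclosureHistoryAutonomyEnd

open Literature.MathematicalPhysics.QuantumFieldTheory.Balaban1983to89
open Literature.MathematicalPhysics.QuantumFieldTheory.Balaban1983to89.FlowStep
open Literature.MathematicalPhysics.QuantumFieldTheory.Balaban1983to89.T4CouplingMatching
open Literature.MathematicalPhysics.QuantumFieldTheory.Balaban1983to89.T4CauchySum (InjectedRate)
open Literature.MathematicalPhysics.QuantumFieldTheory.Balaban1983to89.T4ContinuumCoupling
open Literature.MathematicalPhysics.QuantumFieldTheory.Balaban1983to89.T4BetaStationary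
open Literature.MathematicalPhysics.QuantumFieldTheory.Balaban1983to89.T4BetaFlowWellPosed (MemFlow solution)
open Summit.QuantumFields.BalabanUV.Beta.EriceRemainderEnclosureHistoryAutonomy
open Summit.QuantumFields.BalabanUV.Beta.EriceRemainderEnclosureHistoryAutonomyWellPosed

variable {β : HBeta} {γ c θ : ℝ} {Λ : ℕ → ℕ → ℝ} {M : ℝ}

/-! ## §1 The rows of the history modulus are the zeroth moment of the limit functional -/

/-- **ROWS ⟹ ZEROTH MOMENT OF `betaInf β`.**  `ScaleShiftRate c θ γ β` (`θ < 1`, for the limit to exist), `HistLipschitz Λ γ β`, `Λ ≥ 0`,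
rows `Σ_{i≤k} Λ k i ≤ M` ⟹ for box histories `u, u′` with `|u j − u′ j| ≤ D` for all `j`: `|betaInf β u − betaInf β u′| ≤ M·D`.  (Each
prefix difference is `≤ Σ_i Λ k i·D ≤ M·D`; pass to the limit.)  NO fading, NO profile, NO reindexing by age. [folklore] -/
theorem zerothMoment_betaInf_of_rows (hss : ScaleShiftRate c θ γ β) (hθ1 : θ < 1) (hL : HistLipschitz Λ γ β)
    (hΛ : ∀ k i, i ≤ k → 0 ≤ Λ k i) (hrow : ∀ k, ∑ i ∈ range (k + 1), Λ k i ≤ M) :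
    ∀ u u' : ℕ → ℝ, SeqBox γ u → SeqBox γ u' → ∀ D : ℝ, (∀ j, |u j - u' j| ≤ D) →
      |betaInf β u - betaInf β u'| ≤ M * D := by
  intro u u' hu hu' D hD
  have hD0 : 0 ≤ D := (abs_nonneg _).trans (hD 0)
  have ht := ((tendsto_betaInf hss hθ1 hu).sub (tendsto_betaInf hss hθ1 hu')).abs
  refine le_of_tendsto' ht fun k => ?_
  have hsum : ∑ i : Fin (k + 1), Λ k i ≤ M := by
    rw [Fin.sum_univ_eq_sum_range (fun i => Λ k i) (k + 1)]
    exact hrow k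
  calc |β k (revHist u k) - β k (revHist u' k)|
      ≤ ∑ i : Fin (k + 1), Λ k i * |revHist u k i - revHist u' k i| :=
        hL k _ _ (revHist_mem_box hu k) (revHist_mem_box hu' k)
    _ ≤ ∑ i : Fin (k + 1), Λ k i * D := by
        refine Finset.sum_le_sum fun i _ => mul_le_mul_of_nonneg_left ?_ (hΛ k i (Nat.lt_succ_iff.mp i.2))
        rw [revHist_apply, revHist_apply]
        exact hD _
    _ = (∑ i : Fin (k + 1), Λ k i) * D := by rw [Finset.sum_mul]
    _ ≤ M * D := mul_le_mul_of_nonneg_right hsum hD0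

/-- A row budget of nonnegative moduli is nonnegative. [folklore] -/
theorem rowBound_nonneg (hΛ : ∀ k i, i ≤ k → 0 ≤ Λ k i) (hrow : ∀ k, ∑ i ∈ range (k + 1), Λ k i ≤ M) : 0 ≤ M :=
  (sum_nonneg fun i hi => hΛ 0 i (Nat.lt_succ_iff.mp (mem_range.mp hi))).trans (hrow 0)

/-- CLOSENESS OF LATTICE FAMILIES PASSES TO THE LIMIT FUNCTIONALS: two history families with `ScaleShiftRate` (each its own constants)
that are `η`-close on every box, `|β k v − βt k v| ≤ η`, have `|betaInf β u − betaInf βt u| ≤ η` on the box-valued histories — the input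
`hη` of the stability theorems below, read off lattice data. [folklore] -/
theorem abs_betaInf_sub_betaInf_le_of_close {βt : HBeta} {ct θt η : ℝ} (hss : ScaleShiftRate c θ γ β) (hθ1 : θ < 1)
    (hsst : ScaleShiftRate ct θt γ βt) (hθt1 : θt < 1) (hclose : ∀ k v, v ∈ Box γ k → |β k v - βt k v| ≤ η)
    {u : ℕ → ℝ} (hu : SeqBox γ u) : |betaInf β u - betaInf βt u| ≤ η :=
  le_of_tendsto' (((tendsto_betaInf hss hθ1 hu).sub (tendsto_betaInf hsst hθt1 hu)).abs)
    fun k => hclose k _ (revHist_mem_box hu k)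

/-- UNIFORM CONSEQUENCE: any two values of the limit functional on the box differ by at most `M·γ` (node U2's `abs_betaInf_sub_le`,
`Cm·γ∕(1−θ)`, with the fading binder replaced by rows). [folklore] -/
theorem abs_betaInf_sub_le_of_rows (hss : ScaleShiftRate c θ γ β) (hθ1 : θ < 1) (hL : HistLipschitz Λ γ β)
    (hΛ : ∀ k i, i ≤ k → 0 ≤ Λ k i) (hrow : ∀ k, ∑ i ∈ range (k + 1), Λ k i ≤ M) {u u' : ℕ → ℝ} (hu : SeqBox γ u)
    (hu' : SeqBox γ u') : |betaInf β u - betaInf β u'| ≤ M * γ :=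
  zerothMoment_betaInf_of_rows hss hθ1 hL hΛ hrow u u' hu hu' γ fun j => abs_sub_le_of_seqBox hu hu' j

/-- THE MEMORY OF THE LIMIT FLOW WITHOUT FADING: for any family of runs in the box whose recursion variables converge scale-wise, the
continuum β-values at two physical scales differ by at most `M·γ` (node U2's `abs_bstar_sub_bstar_le` on the weaker binders; (E37a)
`bstar_eq_betaInf_of_tendsto`). [folklore] -/
theorem abs_bstar_sub_bstar_le_of_rows {g : ℕ → ℕ → ℝ} (hbox : ∀ K i, i ≤ K → 0 < g K i ∧ g K i ≤ γ)
    (hrun : ∀ K, RGEqH K β (g K)) (hconv : ∀ m, Tendsto (invSq g m) atTop (𝓝 (astar g m)))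
    (hss : ScaleShiftRate c θ γ β) (hθ0 : 0 ≤ θ) (hθ1 : θ < 1) (hL : HistLipschitz Λ γ β)
    (hΛ : ∀ k i, i ≤ k → 0 ≤ Λ k i) (hrow : ∀ k, ∑ i ∈ range (k + 1), Λ k i ≤ M) (m m' : ℕ) :
    |bstar g m - bstar g m'| ≤ M * γ := by
  rw [bstar_eq_betaInf_of_tendsto hbox hrun hconv hss hθ0 hθ1 (betaContH_of_histLipschitz hL) m,
    bstar_eq_betaInf_of_tendsto hbox hrun hconv hss hθ0 hθ1 (betaContH_of_histLipschitz hL) m']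
  exact abs_betaInf_sub_le_of_rows hss hθ1 hL hΛ hrow (limHist_seqBox_of_tendsto hbox hconv m)
    (limHist_seqBox_of_tendsto hbox hconv m')

/-! ## §2 Node U2's §5 with `FadingMemory` deleted: `InjectedRate` + rows `≤ M` + `M·γ < b` -/

section InjectedRateClass

variable {βt : HBeta} {g gt : ℕ → ℕ → ℝ} {gIR gIRt C θ₁ θs Ct θt ct θst Mt b η : ℝ} {Λt : ℕ → ℕ → ℝ} {k₀ k₀t : ℕ}

/-- **THE CONTINUUM RUNNING COUPLING IS THE UNIQUE BOX SOLUTION OF THE FLOW WITH MEMORY — NO FADING.**  Node U2's `eq_gstar_of_memFlow`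
binder list with `FadingMemory Cm θs Λ` REPLACED by `Λ ≥ 0` + rows `Σ_{i≤k} Λ k i ≤ M` and `Cm·γ < b(1−θs)` by `M·γ < b`: ANY box solution of
the `betaInf β`-flow from `g_IR` is `gstar g`. [folklore] -/
theorem eq_gstar_of_memFlow_rows (hθ1 : θ₁ < 1) (hinj : InjectedRate C 0 θ₁ (fun K j => disc (g K) (g (K + 1)) j))
    (hbox : ∀ K i, i ≤ K → 0 < g K i ∧ g K i ≤ γ) (hrun : ∀ K, RGEqH K β (g K)) (hpin : ∀ K, g K K = gIR)
    (hss : ScaleShiftRate c θs γ β) (hL : HistLipschitz Λ γ β) (hΛ : ∀ k i, i ≤ k → 0 ≤ Λ k i)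
    (hrow : ∀ k, ∑ i ∈ range (k + 1), Λ k i ≤ M) (hθs0 : 0 ≤ θs) (hθs1 : θs < 1) (hev : EventualLowerH b γ k₀ β)
    (hb : 0 < b) (hsmall : M * γ < b) {h : ℕ → ℝ} (hh : SeqBox γ h) (hf : MemFlow (betaInf β) gIR h) : h = gstar g := by
  have hgIR : 0 < gIR := by rw [← hpin 0]; exact (hbox 0 0 le_rfl).1
  have hgIRγ : gIR ≤ γ := by rw [← hpin 0]; exact (hbox 0 0 le_rfl).2
  have hconv : ∀ m, Tendsto (invSq g m) atTop (𝓝 (astar g m)) := fun m => tendsto_invSq hθ1 hinj m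
  exact memFlow_unique_zm (zerothMoment_betaInf_of_rows hss hθs1 hL hΛ hrow) (rowBound_nonneg hΛ hrow) hgIR hgIRγ hb
    (fun u hu => le_betaInf_of_eventualLower hss hθs1 hev hu) hsmall hh (seqBox_gstar_of_tendsto hbox hconv) hf
    (memFlow_gstar_of_injectedRate hθ1 hinj hbox hrun hpin hss hL hθs0 hθs1)

/-- … WELL-POSEDNESS of the `betaInf β`-flow on the box, its solution being `gstar g`. [folklore] -/
theorem existsUnique_memFlow_betaInf_rows (hθ1 : θ₁ < 1)
    (hinj : InjectedRate C 0 θ₁ (fun K j => disc (g K) (g (K + 1)) j))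
    (hbox : ∀ K i, i ≤ K → 0 < g K i ∧ g K i ≤ γ) (hrun : ∀ K, RGEqH K β (g K)) (hpin : ∀ K, g K K = gIR)
    (hss : ScaleShiftRate c θs γ β) (hL : HistLipschitz Λ γ β) (hΛ : ∀ k i, i ≤ k → 0 ≤ Λ k i)
    (hrow : ∀ k, ∑ i ∈ range (k + 1), Λ k i ≤ M) (hθs0 : 0 ≤ θs) (hθs1 : θs < 1) (hev : EventualLowerH b γ k₀ β)
    (hb : 0 < b) (hsmall : M * γ < b) :
    (∃! h : ℕ → ℝ, SeqBox γ h ∧ MemFlow (betaInf β) gIR h) ∧ SeqBox γ (gstar g) ∧ MemFlow (betaInf β) gIR (gstar g) := by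
  have hconv : ∀ m, Tendsto (invSq g m) atTop (𝓝 (astar g m)) := fun m => tendsto_invSq hθ1 hinj m
  have hsol := seqBox_gstar_of_tendsto hbox hconv
  have hmem := memFlow_gstar_of_injectedRate hθ1 hinj hbox hrun hpin hss hL hθs0 hθs1
  exact ⟨⟨gstar g, ⟨hsol, hmem⟩, fun h hh =>
    eq_gstar_of_memFlow_rows hθ1 hinj hbox hrun hpin hss hL hΛ hrow hθs0 hθs1 hev hb hsmall hh.1 hh.2⟩, hsol, hmem⟩

/-- … and `gstar g` is the scale-wise limit of the lattice-free Picard iterates of `betaInf β` from the constant history `g_IR`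
(node U2's `gstar_eq_solution`, no fading). [folklore] -/
theorem gstar_eq_solution_rows (hθ1 : θ₁ < 1) (hinj : InjectedRate C 0 θ₁ (fun K j => disc (g K) (g (K + 1)) j))
    (hbox : ∀ K i, i ≤ K → 0 < g K i ∧ g K i ≤ γ) (hrun : ∀ K, RGEqH K β (g K)) (hpin : ∀ K, g K K = gIR)
    (hss : ScaleShiftRate c θs γ β) (hL : HistLipschitz Λ γ β) (hΛ : ∀ k i, i ≤ k → 0 ≤ Λ k i)
    (hrow : ∀ k, ∑ i ∈ range (k + 1), Λ k i ≤ M) (hθs0 : 0 ≤ θs) (hθs1 : θs < 1) (hev : EventualLowerH b γ k₀ β)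
    (hb : 0 < b) (hsmall : M * γ < b) : gstar g = solution (betaInf β) gIR := by
  have hgIR : 0 < gIR := by rw [← hpin 0]; exact (hbox 0 0 le_rfl).1
  have hgIRγ : gIR ≤ γ := by rw [← hpin 0]; exact (hbox 0 0 le_rfl).2
  have hconv : ∀ m, Tendsto (invSq g m) atTop (𝓝 (astar g m)) := fun m => tendsto_invSq hθ1 hinj m
  exact eq_solution_of_memFlow_zm (zerothMoment_betaInf_of_rows hss hθs1 hL hΛ hrow) (rowBound_nonneg hΛ hrow) hgIR hgIRγ
    hb (fun u hu => le_betaInf_of_eventualLower hss hθs1 hev hu) hsmall (seqBox_gstar_of_tendsto hbox hconv)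
    (memFlow_gstar_of_injectedRate hθ1 hinj hbox hrun hpin hss hL hθs0 hθs1)

/-- **STABILITY ACROSS LATTICE FAMILIES — NO FADING.**  Two families of pinned runs — `g` for `β` (rows `≤ M`, floor `b`, `M·γ < b`), `gt` for
ANOTHER family `βt` (its own output shape, NE4 rate and ANY `HistLipschitz` modulus; no rows, no floor, no smallness) — whose limit
functionals are `η`-close on the box have continuum running couplings within `(γ³·|1∕g_IR² − 1∕g_IRt²| + (γ∕b)·η)∕(1 − M·γ∕b)` at EVERY
scale (node U2's `abs_gstar_sub_gstar_le_of_betaInf_close` on the weaker binders). [folklore] -/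
theorem abs_gstar_sub_gstar_le_of_betaInf_close_rows (hθ1 : θ₁ < 1)
    (hinj : InjectedRate C 0 θ₁ (fun K j => disc (g K) (g (K + 1)) j))
    (hbox : ∀ K i, i ≤ K → 0 < g K i ∧ g K i ≤ γ) (hrun : ∀ K, RGEqH K β (g K)) (hpin : ∀ K, g K K = gIR)
    (hss : ScaleShiftRate c θs γ β) (hL : HistLipschitz Λ γ β) (hΛ : ∀ k i, i ≤ k → 0 ≤ Λ k i)
    (hrow : ∀ k, ∑ i ∈ range (k + 1), Λ k i ≤ M) (hθs0 : 0 ≤ θs) (hθs1 : θs < 1) (hev : EventualLowerH b γ k₀ β)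
    (hb : 0 < b) (hsmall : M * γ < b)
    (hθt1 : θt < 1) (hinjt : InjectedRate Ct 0 θt (fun K j => disc (gt K) (gt (K + 1)) j))
    (hboxt : ∀ K i, i ≤ K → 0 < gt K i ∧ gt K i ≤ γ) (hrunt : ∀ K, RGEqH K βt (gt K)) (hpint : ∀ K, gt K K = gIRt)
    (hsst : ScaleShiftRate ct θst γ βt) (hLt : HistLipschitz Λt γ βt) (hθst0 : 0 ≤ θst) (hθst1 : θst < 1)
    (hη : ∀ u, SeqBox γ u → |betaInf β u - betaInf βt u| ≤ η) (m : ℕ) :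
    |gstar g m - gstar gt m| ≤ (γ ^ 3 * |1 / gIR ^ 2 - 1 / gIRt ^ 2| + γ / b * η) / (1 - M * γ / b) := by
  have hgIR : 0 < gIR := by rw [← hpin 0]; exact (hbox 0 0 le_rfl).1
  have hgIRγ : gIR ≤ γ := by rw [← hpin 0]; exact (hbox 0 0 le_rfl).2
  have hconv : ∀ m, Tendsto (invSq g m) atTop (𝓝 (astar g m)) := fun m => tendsto_invSq hθ1 hinj m
  have hconvt : ∀ m, Tendsto (invSq gt m) atTop (𝓝 (astar gt m)) := fun m => tendsto_invSq hθt1 hinjt m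
  exact memFlow_stability_zm (zerothMoment_betaInf_of_rows hss hθs1 hL hΛ hrow) (rowBound_nonneg hΛ hrow) hgIR hgIRγ hb
    (fun u hu => le_betaInf_of_eventualLower hss hθs1 hev hu) hsmall hη (seqBox_gstar_of_tendsto hbox hconv)
    (seqBox_gstar_of_tendsto hboxt hconvt) (memFlow_gstar_of_injectedRate hθ1 hinj hbox hrun hpin hss hL hθs0 hθs1)
    (memFlow_gstar_of_injectedRate hθt1 hinjt hboxt hrunt hpint hsst hLt hθst0 hθst1) m

/-- **THE CONTINUUM RUNNING COUPLING DEPENDS ON THE β-FAMILY ONLY THROUGH ITS LIMIT FUNCTIONAL — NO FADING**: two families with the same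
pin whose limit functionals agree on the box have the same continuum running coupling at every scale. [folklore] -/
theorem gstar_eq_gstar_of_betaInf_agree_rows (hθ1 : θ₁ < 1)
    (hinj : InjectedRate C 0 θ₁ (fun K j => disc (g K) (g (K + 1)) j))
    (hbox : ∀ K i, i ≤ K → 0 < g K i ∧ g K i ≤ γ) (hrun : ∀ K, RGEqH K β (g K)) (hpin : ∀ K, g K K = gIR)
    (hss : ScaleShiftRate c θs γ β) (hL : HistLipschitz Λ γ β) (hΛ : ∀ k i, i ≤ k → 0 ≤ Λ k i)
    (hrow : ∀ k, ∑ i ∈ range (k + 1), Λ k i ≤ M) (hθs0 : 0 ≤ θs) (hθs1 : θs < 1) (hev : EventualLowerH b γ k₀ β)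
    (hb : 0 < b) (hsmall : M * γ < b)
    (hθt1 : θt < 1) (hinjt : InjectedRate Ct 0 θt (fun K j => disc (gt K) (gt (K + 1)) j))
    (hboxt : ∀ K i, i ≤ K → 0 < gt K i ∧ gt K i ≤ γ) (hrunt : ∀ K, RGEqH K βt (gt K)) (hpint : ∀ K, gt K K = gIR)
    (hsst : ScaleShiftRate ct θst γ βt) (hLt : HistLipschitz Λt γ βt) (hθst0 : 0 ≤ θst) (hθst1 : θst < 1)
    (hagree : ∀ u, SeqBox γ u → betaInf β u = betaInf βt u) : gstar g = gstar gt := by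
  have hgIR : 0 < gIR := by rw [← hpin 0]; exact (hbox 0 0 le_rfl).1
  have hgIRγ : gIR ≤ γ := by rw [← hpin 0]; exact (hbox 0 0 le_rfl).2
  have hconv : ∀ m, Tendsto (invSq g m) atTop (𝓝 (astar g m)) := fun m => tendsto_invSq hθ1 hinj m
  have hconvt : ∀ m, Tendsto (invSq gt m) atTop (𝓝 (astar gt m)) := fun m => tendsto_invSq hθt1 hinjt m
  exact memFlow_eq_of_functional_agree_zm (zerothMoment_betaInf_of_rows hss hθs1 hL hΛ hrow) (rowBound_nonneg hΛ hrow) hgIR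
    hgIRγ hb (fun u hu => le_betaInf_of_eventualLower hss hθs1 hev hu) hsmall hagree (seqBox_gstar_of_tendsto hbox hconv)
    (seqBox_gstar_of_tendsto hboxt hconvt) (memFlow_gstar_of_injectedRate hθ1 hinj hbox hrun hpin hss hL hθs0 hθs1)
    (memFlow_gstar_of_injectedRate hθt1 hinjt hboxt hrunt hpint hsst hLt hθst0 hθst1)

end InjectedRateClass

/-! ## §3 (E33)'s rows-only classes as they stand: existence from (E33d), the characterisation from (E37a) + (E37b) -/

section RowsOnlyClass

variable {βt : HBeta} {g gt : ℕ → ℕ → ℝ} {gIR b β' M ct θt : ℝ} {k₀ k₀t : ℕ} {Λt : ℕ → ℕ → ℝ} {Mt bt : ℝ}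

/-- (E33)'s smallness already contains the autonomy threshold: `M ≥ 0`, `γ, b > 0`, `M·((k₀+1)γ³ + 2γ∕b) < 1` ⟹ `M·γ < b`. [folklore] -/
theorem smallness_of_E33 (hM : 0 ≤ M) (hγ : 0 < γ) (hb : 0 < b)
    (hsmall : M * (((k₀ : ℝ) + 1) * γ ^ 3 + 2 * γ / b) < 1) : M * γ < b := by
  have h1 : M * (2 * γ / b) ≤ M * (((k₀ : ℝ) + 1) * γ ^ 3 + 2 * γ / b) :=
    mul_le_mul_of_nonneg_left (le_add_of_nonneg_left (by positivity)) hM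
  have h2 : M * (2 * γ / b) < 1 := h1.trans_lt hsmall
  rw [mul_div_assoc', div_lt_one hb] at h2
  nlinarith [mul_nonneg hM hγ.le]

/-- **THE INTRINSIC CHARACTERISATION WITHOUT FADING MEMORY — (E33)'s SIGN CLASS AS IT STANDS.**  Runs `K ↦ g K` of (0.20) in ]0,γ],
pinned `g K K = g_IR`, ONE history family `β` with `ScaleShiftRate c θ γ β` (`c ≥ 0`, `0 ≤ θ < 1`), `HistLipschitz Λ γ β`, `Λ ≥ 0`, rows
`Σ_{i≤k} Λ k i ≤ M`, the sign `BetaLowerH 0 γ β`, the eventual floor `EventualLowerH b γ k₀ β` (`b > 0`), `M·((k₀+1)γ³ + 2γ∕b) < 1` — NOTHING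
ELSE (no `InjectedRate`, no `FadingMemory`): ANY box solution of the `betaInf β`-flow from `g_IR` IS `gstar g`.
[cite: Balaban1987RG1, (0.20) p.256 and (0.31) p.259] -/
theorem eq_gstar_of_memFlow_sign
    (hγ : 0 < γ) (hb : 0 < b) (hc : 0 ≤ c) (hθ0 : 0 ≤ θ) (hθ1 : θ < 1)
    (hrun : ∀ K, RGEqH K β (g K)) (hbox : ∀ K i, i ≤ K → 0 < g K i ∧ g K i ≤ γ) (hpin : ∀ K, g K K = gIR)
    (hS : ScaleShiftRate c θ γ β) (hL : HistLipschitz Λ γ β) (hΛ : ∀ k i, i ≤ k → 0 ≤ Λ k i) (hM : 0 ≤ M)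
    (hrow : ∀ k, ∑ i ∈ range (k + 1), Λ k i ≤ M)
    (hsign : BetaLowerH 0 γ β) (hlo : EventualLowerH b γ k₀ β)
    (hsmall : M * (((k₀ : ℝ) + 1) * γ ^ 3 + 2 * γ / b) < 1)
    {h : ℕ → ℝ} (hh : SeqBox γ h) (hf : MemFlow (betaInf β) gIR h) : h = gstar g := by
  have hgIR : 0 < gIR := by rw [← hpin 0]; exact (hbox 0 0 le_rfl).1
  have hgIRγ : gIR ≤ γ := by rw [← hpin 0]; exact (hbox 0 0 le_rfl).2
  obtain ⟨hsol, hmem, -⟩ := memFlow_gstar_of_sign hγ hb hc hθ0 hθ1 hrun hbox hpin hS hL hΛ hM hrow hsign hlo hsmall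
  exact memFlow_unique_zm (zerothMoment_betaInf_of_rows hS hθ1 hL hΛ hrow) hM hgIR hgIRγ hb
    (fun u hu => le_betaInf_of_eventualLower hS hθ1 hlo hu) (smallness_of_E33 hM hγ hb hsmall) hh hsol hf hmem

/-- **WELL-POSEDNESS OF THE CONTINUUM FLOW WITH MEMORY — (E33)'s SIGN CLASS**: `∃! h, SeqBox γ h ∧ MemFlow (betaInf β) g_IR h`, the solution
being `gstar g`. [cite: Balaban1987RG1, (0.20) p.256 and (0.31) p.259] -/
theorem existsUnique_memFlow_betaInf_sign
    (hγ : 0 < γ) (hb : 0 < b) (hc : 0 ≤ c) (hθ0 : 0 ≤ θ) (hθ1 : θ < 1)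
    (hrun : ∀ K, RGEqH K β (g K)) (hbox : ∀ K i, i ≤ K → 0 < g K i ∧ g K i ≤ γ) (hpin : ∀ K, g K K = gIR)
    (hS : ScaleShiftRate c θ γ β) (hL : HistLipschitz Λ γ β) (hΛ : ∀ k i, i ≤ k → 0 ≤ Λ k i) (hM : 0 ≤ M)
    (hrow : ∀ k, ∑ i ∈ range (k + 1), Λ k i ≤ M)
    (hsign : BetaLowerH 0 γ β) (hlo : EventualLowerH b γ k₀ β)
    (hsmall : M * (((k₀ : ℝ) + 1) * γ ^ 3 + 2 * γ / b) < 1) :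
    (∃! h : ℕ → ℝ, SeqBox γ h ∧ MemFlow (betaInf β) gIR h) ∧ SeqBox γ (gstar g) ∧ MemFlow (betaInf β) gIR (gstar g) := by
  obtain ⟨hsol, hmem, -⟩ := memFlow_gstar_of_sign hγ hb hc hθ0 hθ1 hrun hbox hpin hS hL hΛ hM hrow hsign hlo hsmall
  exact ⟨⟨gstar g, ⟨hsol, hmem⟩, fun h hh => eq_gstar_of_memFlow_sign hγ hb hc hθ0 hθ1 hrun hbox hpin hS hL hΛ hM hrow
    hsign hlo hsmall hh.1 hh.2⟩, hsol, hmem⟩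

/-- … and `gstar g = solution (betaInf β) g_IR`, the lattice-free Picard limit. [cite: Balaban1987RG1, (0.20) p.256 and (0.31) p.259] -/
theorem gstar_eq_solution_sign
    (hγ : 0 < γ) (hb : 0 < b) (hc : 0 ≤ c) (hθ0 : 0 ≤ θ) (hθ1 : θ < 1)
    (hrun : ∀ K, RGEqH K β (g K)) (hbox : ∀ K i, i ≤ K → 0 < g K i ∧ g K i ≤ γ) (hpin : ∀ K, g K K = gIR)
    (hS : ScaleShiftRate c θ γ β) (hL : HistLipschitz Λ γ β) (hΛ : ∀ k i, i ≤ k → 0 ≤ Λ k i) (hM : 0 ≤ M)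
    (hrow : ∀ k, ∑ i ∈ range (k + 1), Λ k i ≤ M)
    (hsign : BetaLowerH 0 γ β) (hlo : EventualLowerH b γ k₀ β)
    (hsmall : M * (((k₀ : ℝ) + 1) * γ ^ 3 + 2 * γ / b) < 1) : gstar g = solution (betaInf β) gIR := by
  have hgIR : 0 < gIR := by rw [← hpin 0]; exact (hbox 0 0 le_rfl).1
  have hgIRγ : gIR ≤ γ := by rw [← hpin 0]; exact (hbox 0 0 le_rfl).2
  obtain ⟨hsol, hmem, -⟩ := memFlow_gstar_of_sign hγ hb hc hθ0 hθ1 hrun hbox hpin hS hL hΛ hM hrow hsign hlo hsmall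
  exact eq_solution_of_memFlow_zm (zerothMoment_betaInf_of_rows hS hθ1 hL hΛ hrow) hM hgIR hgIRγ hb
    (fun u hu => le_betaInf_of_eventualLower hS hθ1 hlo hu) (smallness_of_E33 hM hγ hb hsmall) hsol hmem

/-- **STABILITY ACROSS LATTICE FAMILIES WITHOUT FADING MEMORY — (E33)'s SIGN CLASS**: two families in the class (each its own constants,
pins `g_IR`, `g_IRt`) whose history families are `η`-close on every box have continuum running couplings within
`(γ³·|1∕g_IR² − 1∕g_IRt²| + (γ∕b)·η)∕(1 − M·γ∕b)` at EVERY scale (only the first family's `M`, `b` enter the constant).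
[cite: Balaban1987RG1, (0.20) p.256 and (0.31) p.259] -/
theorem abs_gstar_sub_gstar_le_of_beta_close_sign {gIRt η : ℝ}
    (hγ : 0 < γ) (hb : 0 < b) (hc : 0 ≤ c) (hθ0 : 0 ≤ θ) (hθ1 : θ < 1)
    (hrun : ∀ K, RGEqH K β (g K)) (hbox : ∀ K i, i ≤ K → 0 < g K i ∧ g K i ≤ γ) (hpin : ∀ K, g K K = gIR)
    (hS : ScaleShiftRate c θ γ β) (hL : HistLipschitz Λ γ β) (hΛ : ∀ k i, i ≤ k → 0 ≤ Λ k i) (hM : 0 ≤ M)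
    (hrow : ∀ k, ∑ i ∈ range (k + 1), Λ k i ≤ M)
    (hsign : BetaLowerH 0 γ β) (hlo : EventualLowerH b γ k₀ β)
    (hsmall : M * (((k₀ : ℝ) + 1) * γ ^ 3 + 2 * γ / b) < 1)
    (hbt : 0 < bt) (hct : 0 ≤ ct) (hθt0 : 0 ≤ θt) (hθt1 : θt < 1)
    (hrunt : ∀ K, RGEqH K βt (gt K)) (hboxt : ∀ K i, i ≤ K → 0 < gt K i ∧ gt K i ≤ γ) (hpint : ∀ K, gt K K = gIRt)
    (hSt : ScaleShiftRate ct θt γ βt) (hLt : HistLipschitz Λt γ βt) (hΛt : ∀ k i, i ≤ k → 0 ≤ Λt k i) (hMt : 0 ≤ Mt)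
    (hrowt : ∀ k, ∑ i ∈ range (k + 1), Λt k i ≤ Mt)
    (hsignt : BetaLowerH 0 γ βt) (hlot : EventualLowerH bt γ k₀t βt)
    (hsmallt : Mt * (((k₀t : ℝ) + 1) * γ ^ 3 + 2 * γ / bt) < 1)
    (hclose : ∀ k v, v ∈ Box γ k → |β k v - βt k v| ≤ η) (m : ℕ) :
    |gstar g m - gstar gt m| ≤ (γ ^ 3 * |1 / gIR ^ 2 - 1 / gIRt ^ 2| + γ / b * η) / (1 - M * γ / b) := by
  have hgIR : 0 < gIR := by rw [← hpin 0]; exact (hbox 0 0 le_rfl).1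
  have hgIRγ : gIR ≤ γ := by rw [← hpin 0]; exact (hbox 0 0 le_rfl).2
  obtain ⟨hsol, hmem, -⟩ := memFlow_gstar_of_sign hγ hb hc hθ0 hθ1 hrun hbox hpin hS hL hΛ hM hrow hsign hlo hsmall
  obtain ⟨hsolt, hmemt, -⟩ :=
    memFlow_gstar_of_sign hγ hbt hct hθt0 hθt1 hrunt hboxt hpint hSt hLt hΛt hMt hrowt hsignt hlot hsmallt
  exact memFlow_stability_zm (zerothMoment_betaInf_of_rows hS hθ1 hL hΛ hrow) hM hgIR hgIRγ hb
    (fun u hu => le_betaInf_of_eventualLower hS hθ1 hlo hu) (smallness_of_E33 hM hγ hb hsmall)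
    (fun u hu => abs_betaInf_sub_betaInf_le_of_close hS hθ1 hSt hθt1 hclose hu) hsol hsolt hmem hmemt m

/-- **UNIVERSALITY WITHOUT FADING MEMORY**: two families in (E33)'s sign class (each with its own constants) with the SAME pin whose limit
functionals AGREE on the box have the SAME continuum running coupling at every scale. [cite: Balaban1987RG1, (0.20) p.256 and (0.31) p.259] -/
theorem gstar_eq_gstar_of_betaInf_agree_sign
    (hγ : 0 < γ) (hb : 0 < b) (hc : 0 ≤ c) (hθ0 : 0 ≤ θ) (hθ1 : θ < 1)
    (hrun : ∀ K, RGEqH K β (g K)) (hbox : ∀ K i, i ≤ K → 0 < g K i ∧ g K i ≤ γ) (hpin : ∀ K, g K K = gIR)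
    (hS : ScaleShiftRate c θ γ β) (hL : HistLipschitz Λ γ β) (hΛ : ∀ k i, i ≤ k → 0 ≤ Λ k i) (hM : 0 ≤ M)
    (hrow : ∀ k, ∑ i ∈ range (k + 1), Λ k i ≤ M)
    (hsign : BetaLowerH 0 γ β) (hlo : EventualLowerH b γ k₀ β)
    (hsmall : M * (((k₀ : ℝ) + 1) * γ ^ 3 + 2 * γ / b) < 1)
    (hbt : 0 < bt) (hct : 0 ≤ ct) (hθt0 : 0 ≤ θt) (hθt1 : θt < 1)
    (hrunt : ∀ K, RGEqH K βt (gt K)) (hboxt : ∀ K i, i ≤ K → 0 < gt K i ∧ gt K i ≤ γ) (hpint : ∀ K, gt K K = gIR)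
    (hSt : ScaleShiftRate ct θt γ βt) (hLt : HistLipschitz Λt γ βt) (hΛt : ∀ k i, i ≤ k → 0 ≤ Λt k i) (hMt : 0 ≤ Mt)
    (hrowt : ∀ k, ∑ i ∈ range (k + 1), Λt k i ≤ Mt)
    (hsignt : BetaLowerH 0 γ βt) (hlot : EventualLowerH bt γ k₀t βt)
    (hsmallt : Mt * (((k₀t : ℝ) + 1) * γ ^ 3 + 2 * γ / bt) < 1)
    (hagree : ∀ u, SeqBox γ u → betaInf β u = betaInf βt u) : gstar g = gstar gt := by
  have hgIR : 0 < gIR := by rw [← hpin 0]; exact (hbox 0 0 le_rfl).1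
  have hgIRγ : gIR ≤ γ := by rw [← hpin 0]; exact (hbox 0 0 le_rfl).2
  obtain ⟨hsol, hmem, -⟩ := memFlow_gstar_of_sign hγ hb hc hθ0 hθ1 hrun hbox hpin hS hL hΛ hM hrow hsign hlo hsmall
  obtain ⟨hsolt, hmemt, -⟩ :=
    memFlow_gstar_of_sign hγ hbt hct hθt0 hθt1 hrunt hboxt hpint hSt hLt hΛt hMt hrowt hsignt hlot hsmallt
  exact memFlow_eq_of_functional_agree_zm (zerothMoment_betaInf_of_rows hS hθ1 hL hΛ hrow) hM hgIR hgIRγ hb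
    (fun u hu => le_betaInf_of_eventualLower hS hθ1 hlo hu) (smallness_of_E33 hM hγ hb hsmall) hagree hsol hsolt hmem hmemt

/-- (E33)'s eventual-class smallness `2√2·M·U < 1` contains the autonomy threshold too (`2√2 ≥ 1`). [folklore] -/
theorem smallness_of_E33_eventual (hM : 0 ≤ M) (hγ : 0 < γ) (hb : 0 < b)
    (hsmall : 2 * Real.sqrt 2 * M * (((k₀ : ℝ) + 1) * γ ^ 3 + 2 * γ / b) < 1) : M * γ < b := by
  refine smallness_of_E33 (k₀ := k₀) hM hγ hb (lt_of_le_of_lt ?_ hsmall)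
  have h2 : (1 : ℝ) ≤ 2 * Real.sqrt 2 := by nlinarith [Real.sqrt_nonneg 2, Real.sq_sqrt (show (0:ℝ) ≤ 2 by norm_num)]
  have h0 : 0 ≤ M * (((k₀ : ℝ) + 1) * γ ^ 3 + 2 * γ / b) := mul_nonneg hM (by positivity)
  nlinarith

/-- **(E33)'s EVENTUAL CLASS AS IT STANDS** (no sign; `β ≥ −β′` on the boxes, `k₀β′γ² ≤ 1∕2`, `2√2·M·((k₀+1)γ³ + 2γ∕b) < 1`): ANY box solution of
the `betaInf β`-flow from `g_IR` IS `gstar g`. [cite: Balaban1987RG1, (0.20) p.256 and §1 p.264] -/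
theorem eq_gstar_of_memFlow_eventual
    (hγ : 0 < γ) (hb : 0 < b) (hc : 0 ≤ c) (hθ0 : 0 ≤ θ) (hθ1 : θ < 1)
    (hrun : ∀ K, RGEqH K β (g K)) (hbox : ∀ K i, i ≤ K → 0 < g K i ∧ g K i ≤ γ) (hpin : ∀ K, g K K = gIR)
    (hS : ScaleShiftRate c θ γ β) (hL : HistLipschitz Λ γ β) (hΛ : ∀ k i, i ≤ k → 0 ≤ Λ k i) (hM : 0 ≤ M)
    (hrow : ∀ k, ∑ i ∈ range (k + 1), Λ k i ≤ M)
    (hlo : EventualLowerH b γ k₀ β) (hβ' : 0 ≤ β') (hlow : ∀ k v, v ∈ Box γ k → -β' ≤ β k v)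
    (hk₀ : (k₀ : ℝ) * β' * γ ^ 2 ≤ 1 / 2)
    (hsmall : 2 * Real.sqrt 2 * M * (((k₀ : ℝ) + 1) * γ ^ 3 + 2 * γ / b) < 1)
    {h : ℕ → ℝ} (hh : SeqBox γ h) (hf : MemFlow (betaInf β) gIR h) : h = gstar g := by
  have hgIR : 0 < gIR := by rw [← hpin 0]; exact (hbox 0 0 le_rfl).1
  have hgIRγ : gIR ≤ γ := by rw [← hpin 0]; exact (hbox 0 0 le_rfl).2
  obtain ⟨hsol, hmem, -⟩ :=
    memFlow_gstar_of_eventual hγ hb hc hθ0 hθ1 hrun hbox hpin hS hL hΛ hM hrow hlo hβ' hlow hk₀ hsmall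
  exact memFlow_unique_zm (zerothMoment_betaInf_of_rows hS hθ1 hL hΛ hrow) hM hgIR hgIRγ hb
    (fun u hu => le_betaInf_of_eventualLower hS hθ1 hlo hu) (smallness_of_E33_eventual hM hγ hb hsmall) hh hsol hf hmem

end RowsOnlyClass

end Summit.QuantumFields.BalabanUV.Beta.EriceRemainderEnclosureHistoryAutonomyEnd

end
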